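import Summits.RiemannHypothesis.RiemannHypothesis.Theorems.WeilFormatCDataO94TabValid1
import Summits.RiemannHypothesis.RiemannHypothesis.Theorems.WeilFormatCDataO94TabValid2
import Summits.RiemannHypothesis.RiemannHypothesis.Theorems.WeilFormatCDataO94TabValid3
import Summits.RiemannHypothesis.RiemannHypothesis.Theorems.WeilFormatCDataO94TabValid4
import Summits.RiemannHypothesis.RiemannHypothesis.Theorems.WeilFormatCDataO94TabValid
import Summits.RiemannHypothesis.RiemannHypothesis.Theorems.WeilFormatCDataO94ColSlice0
import Summits.RiemannHypothesis.RiemannHypothesis.Theorems.WeilFormatCDataO94ColSlice1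
import Summits.RiemannHypothesis.RiemannHypothesis.Theorems.WeilFormatCDataO94ColSlice2
import Summits.RiemannHypothesis.RiemannHypothesis.Theorems.WeilFormatCDataO94ColSlice3
import Summits.RiemannHypothesis.RiemannHypothesis.Theorems.WeilFormatCDataO94ColSlice4
import Summits.RiemannHypothesis.RiemannHypothesis.Theorems.WeilFormatCDataO94ColSlice5B
import Summits.RiemannHypothesis.RiemannHypothesis.Theorems.WeilFormatCDataO94ColSlice6B
import Summits.RiemannHypothesis.RiemannHypothesis.Theorems.WeilFormatCDataO94ColSlice7B
import Summits.RiemannHypothesis.RiemannHypothesis.Theorems.WeilFormatCDataO94ColSlice8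
import Summits.RiemannHypothesis.RiemannHypothesis.Theorems.WeilFormatCDataO94ColSlice9
import Summits.RiemannHypothesis.RiemannHypothesis.Theorems.WeilFormatCDataO94ColSlice10
import Summits.RiemannHypothesis.RiemannHypothesis.Theorems.WeilFormatCDataO94ColSlice11
import Summits.RiemannHypothesis.RiemannHypothesis.Theorems.WeilFormatCDataO94ColSlice12
import Summits.RiemannHypothesis.RiemannHypothesis.Theorems.WeilFormatCDataO94ColSlice13
import Summits.RiemannHypothesis.RiemannHypothesis.Theorems.WeilFormatCDataO94ColSlice14
import Summits.RiemannHypothesis.RiemannHypothesis.Theorems.WeilFormatCDataO94FrontB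
import Summits.RiemannHypothesis.RiemannHypothesis.Theorems.WeilFormatCDataO94FrontW1
import Summits.RiemannHypothesis.RiemannHypothesis.Theorems.WeilFormatCDataO94FrontW2
import Summits.RiemannHypothesis.RiemannHypothesis.Theorems.WeilFormatCDataA1RungCB
import Summits.RiemannHypothesis.RiemannHypothesis.Theorems.WeilFormatCDataO94Mid
import Summits.RiemannHypothesis.RiemannHypothesis.Theorems.WeilFormatCDataO94CBOddCols0
import Summits.RiemannHypothesis.RiemannHypothesis.Theorems.WeilFormatCDataO94CBOddCols1
import Summits.RiemannHypothesis.RiemannHypothesis.Theorems.WeilFormatCDataO94CBOddCols2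
import Summits.RiemannHypothesis.RiemannHypothesis.Theorems.WeilFormatCDataO94CBOddCols3
import Summits.RiemannHypothesis.RiemannHypothesis.Theorems.WeilFormatCDataO94CBOddCols4
import Summits.RiemannHypothesis.RiemannHypothesis.Theorems.WeilFormatCDataO94CBOddTailPsi0B
import Summits.RiemannHypothesis.RiemannHypothesis.Theorems.WeilFormatCDataO94CBOddTail
import Summits.RiemannHypothesis.RiemannHypothesis.Theorems.WeilFormatCDataO94CBOddSchur0
import Summits.RiemannHypothesis.RiemannHypothesis.Theorems.WeilFormatCDataO94CBOddSchur1
import Summits.RiemannHypothesis.RiemannHypothesis.Theorems.WeilFormatCDataO94CBOddSchur2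
import Summits.RiemannHypothesis.RiemannHypothesis.Theorems.WeilFormatCDataO94CBOddSchur3
import Summits.RiemannHypothesis.RiemannHypothesis.Theorems.WeilFormatCDataO94CBOddSchur4
import Summits.RiemannHypothesis.RiemannHypothesis.Theorems.WeilFormatCDataO94CBOddSchur5
import Summits.RiemannHypothesis.RiemannHypothesis.Theorems.WeilFormatCDataO94CBOddSchur6
import Summits.RiemannHypothesis.RiemannHypothesis.Theorems.WeilFormatCDataO94CBOddSchur7
import Summits.RiemannHypothesis.RiemannHypothesis.Theorems.WeilFormatCDataO94CBOddSchur8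
import Summits.RiemannHypothesis.RiemannHypothesis.Theorems.WeilFormatCDataO94CBOddSchur9
import Summits.RiemannHypothesis.RiemannHypothesis.Theorems.WeilFormatCDataO94CBOddSchur10
import Summits.RiemannHypothesis.RiemannHypothesis.Theorems.WeilFormatCDataO94CBOddSchur11
import Summits.RiemannHypothesis.RiemannHypothesis.Theorems.WeilFormatCDataO94CBOddSchur12
import Summits.RiemannHypothesis.RiemannHypothesis.Theorems.WeilFormatCDataO94CBOddSchur13
import Summits.RiemannHypothesis.RiemannHypothesis.Theorems.WeilFormatCDataO94CBOddSchur14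
import Summits.RiemannHypothesis.RiemannHypothesis.Theorems.WeilFormatCDataO94CBOddSchur15
import Summits.RiemannHypothesis.RiemannHypothesis.Theorems.WeilFormatCDataO94CBOddSchur16
import Summits.RiemannHypothesis.RiemannHypothesis.Theorems.WeilFormatCDataO94CBOddPsd0
import Summits.RiemannHypothesis.RiemannHypothesis.Theorems.WeilFormatCDataO94CBOddPsd1
import Summits.RiemannHypothesis.RiemannHypothesis.Theorems.WeilFormatCDataO94CBOddPsd2
import Summits.RiemannHypothesis.RiemannHypothesis.Theorems.WeilFormatCDataO94CBOddPsd3B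
import Summits.RiemannHypothesis.RiemannHypothesis.Theorems.S2FormatCE0
import Literature.NumberTheory.LFunctions.YoshidaWindowGramTailMSSines
import Literature.NumberTheory.LFunctions.YoshidaWindowGramMiddleJBox
import Literature.NumberTheory.LFunctions.YoshidaWindowGramTailJFactoredScaled
import Literature.NumberTheory.LFunctions.YoshidaWindowGramTailMSFactored
import Literature.NumberTheory.LFunctions.YoshidaWindowGramTailJDiagTight
import Summits.RiemannHypothesis.RiemannHypothesis.Theorems.FormatCPsdBands
import Summits.RiemannHypothesis.RiemannHypothesis.Theorems.WeilFormatCDiagShift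
import HarnessLib

/-!
# Format C kernel rung `O94` (a = 47/50, column-band layout): ASSEMBLY of the flat layout, part A of 5 (ladders of TabValid1, TabValid2, TabValid3; split of the 1286-line assembly at block boundaries by prover B g18 for the 400-line cap; blocks byte-identical): every propositional ladder of the kernel files (table/column validity, front door, sines, middle moments, column data, tail factors, Schur rows, (P) + diagonal shift), byte-identical statements and proofs, original order (A g22 restage_flat.py; weil-2 KERNEL-CHAIN-RULES #1)

Window `a = 47/50`; prime powers in the window: 2, 3, 2^2, 5; prime constant A = 1825/1000 (`WeilFormatC.primeCoeff_form_ge_cells_09729`); evaluator parameters S = 2^256, Kpi 130, Kser 150, kred 8, Kexp 45, J 120; full table modes < 161; light column table modes < 1027; units 2^-250 (Schur entries), 2^-124 (column digits, width 127), 2^-118 (tail-factor digits, width 121), 2^-64 (reciprocal weights), 2^-40 (tail base); order-J tail J = 4, θ = 1/2048, η = 1/10 | 4/1.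
Design row: sr-gb-rung-a odd λ-run (parity cell 10 L-side): a = 47/50, μ = 2^-75, odd 160/320/1024, MS tail; see HOME(A)/LADDER-LSIDES-FORMATC-A-g22.md. Generated by sr-gb-rung-a prover A g22 with rh-explicit-weil-2 gen7's generator extended for the odd λ-run (--sector odd --mu-log2; HOME(A)/code-g22/gen7/gramgen7.py sha16 172ee47dc0b1c923) from `#eval` of the tree's `Encl` functions; every datum is re-verified by the kernel in the theorem files (`decide +kernel`). Helper data of the rh-explicit Weil-positivity programme (format C, K-CELL-2), RH-free. [cite: Yoshida1992HermitianForms, §5 (5.15)-(5.16) p. 301; §7 pp. 305–312]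
-/

set_option linter.dupNamespace false
set_option maxRecDepth 200000

-- ===== from WeilFormatCDataO94TabValid1 =====
namespace Summit.RiemannHypothesis.RiemannHypothesis.Theorems.WeilFormatCData.O94
open Literature.NumberTheory.LFunctions Literature.NumberTheory.LFunctions.Yoshida1992 Encl Literature.Analysis.ValidatedNumerics.NumericsMP

/-- `π ∈ P`. -/
theorem pi_mem : MI.mem (2 ^ 256) Real.pi O94.P := mem_pi_of_checkPi (by norm_num) tP

/-- `a ∈ A`. -/
theorem a_mem : MI.mem (2 ^ 256) O94.a O94.A := by
  unfold a
  exact mem_of_checkFrac tA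

/-- `0 < a` (window written out; `a` unfolds to it). -/
theorem a_pos : (0 : ℝ) < (((47 : ℤ) : ℝ) / (50 : ℕ)) := by
  positivity

/-- the constants are valid for `a`. -/
theorem consts_valid : ConstsValid (2 ^ 256) O94.a O94.ks O94.C :=
  constsValid_of_checkConsts (prm := prm) (by norm_num [prm]) (by norm_num [prm]) pi_mem a_mem tC

/-- the prime data is valid for `a` (prime list written out). -/
theorem primeData : PrimeData O94.a [⟨2, 1⟩, ⟨3, 1⟩, ⟨2, 2⟩, ⟨5, 1⟩] := primeData_of_checkSep (by norm_num) a_mem tK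

/-- the special-value table is valid below `26` (partial). -/
theorem tabv26 : TabValid (2 ^ 256) O94.a O94.ks 26 O94.tab := by
  have h0 : TabValid (2 ^ 256) a ks 0 tab := TabValid.zero
  have h1 : TabValid (2 ^ 256) a ks (0 + 1) tab :=
    h0.extend fun n hn hnk ↦ idxValid_of_checkTable (prm := prm) (by norm_num [prm]) a_pos consts_valid tT0 hn hnk
  have h2 : TabValid (2 ^ 256) a ks (1 + 1) tab :=
    h1.extend fun n hn hnk ↦ idxValid_of_checkTable (prm := prm) (by norm_num [prm]) a_pos consts_valid tT1 hn hnk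
  have h3 : TabValid (2 ^ 256) a ks (2 + 1) tab :=
    h2.extend fun n hn hnk ↦ idxValid_of_checkTable (prm := prm) (by norm_num [prm]) a_pos consts_valid tT2 hn hnk
  have h4 : TabValid (2 ^ 256) a ks (3 + 1) tab :=
    h3.extend fun n hn hnk ↦ idxValid_of_checkTable (prm := prm) (by norm_num [prm]) a_pos consts_valid tT3 hn hnk
  have h5 : TabValid (2 ^ 256) a ks (4 + 1) tab :=
    h4.extend fun n hn hnk ↦ idxValid_of_checkTable (prm := prm) (by norm_num [prm]) a_pos consts_valid tT4 hn hnk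
  have h6 : TabValid (2 ^ 256) a ks (5 + 1) tab :=
    h5.extend fun n hn hnk ↦ idxValid_of_checkTable (prm := prm) (by norm_num [prm]) a_pos consts_valid tT5 hn hnk
  have h7 : TabValid (2 ^ 256) a ks (6 + 1) tab :=
    h6.extend fun n hn hnk ↦ idxValid_of_checkTable (prm := prm) (by norm_num [prm]) a_pos consts_valid tT6 hn hnk
  have h8 : TabValid (2 ^ 256) a ks (7 + 1) tab :=
    h7.extend fun n hn hnk ↦ idxValid_of_checkTable (prm := prm) (by norm_num [prm]) a_pos consts_valid tT7 hn hnk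
  have h9 : TabValid (2 ^ 256) a ks (8 + 1) tab :=
    h8.extend fun n hn hnk ↦ idxValid_of_checkTable (prm := prm) (by norm_num [prm]) a_pos consts_valid tT8 hn hnk
  have h10 : TabValid (2 ^ 256) a ks (9 + 1) tab :=
    h9.extend fun n hn hnk ↦ idxValid_of_checkTable (prm := prm) (by norm_num [prm]) a_pos consts_valid tT9 hn hnk
  have h11 : TabValid (2 ^ 256) a ks (10 + 1) tab :=
    h10.extend fun n hn hnk ↦ idxValid_of_checkTable (prm := prm) (by norm_num [prm]) a_pos consts_valid tT10 hn hnk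
  have h12 : TabValid (2 ^ 256) a ks (11 + 1) tab :=
    h11.extend fun n hn hnk ↦ idxValid_of_checkTable (prm := prm) (by norm_num [prm]) a_pos consts_valid tT11 hn hnk
  have h13 : TabValid (2 ^ 256) a ks (12 + 1) tab :=
    h12.extend fun n hn hnk ↦ idxValid_of_checkTable (prm := prm) (by norm_num [prm]) a_pos consts_valid tT12 hn hnk
  have h14 : TabValid (2 ^ 256) a ks (13 + 1) tab :=
    h13.extend fun n hn hnk ↦ idxValid_of_checkTable (prm := prm) (by norm_num [prm]) a_pos consts_valid tT13 hn hnk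
  have h15 : TabValid (2 ^ 256) a ks (14 + 1) tab :=
    h14.extend fun n hn hnk ↦ idxValid_of_checkTable (prm := prm) (by norm_num [prm]) a_pos consts_valid tT14 hn hnk
  have h16 : TabValid (2 ^ 256) a ks (15 + 1) tab :=
    h15.extend fun n hn hnk ↦ idxValid_of_checkTable (prm := prm) (by norm_num [prm]) a_pos consts_valid tT15 hn hnk
  have h17 : TabValid (2 ^ 256) a ks (16 + 1) tab :=
    h16.extend fun n hn hnk ↦ idxValid_of_checkTable (prm := prm) (by norm_num [prm]) a_pos consts_valid tT16 hn hnk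
  have h18 : TabValid (2 ^ 256) a ks (17 + 1) tab :=
    h17.extend fun n hn hnk ↦ idxValid_of_checkTable (prm := prm) (by norm_num [prm]) a_pos consts_valid tT17 hn hnk
  have h19 : TabValid (2 ^ 256) a ks (18 + 1) tab :=
    h18.extend fun n hn hnk ↦ idxValid_of_checkTable (prm := prm) (by norm_num [prm]) a_pos consts_valid tT18 hn hnk
  have h20 : TabValid (2 ^ 256) a ks (19 + 1) tab :=
    h19.extend fun n hn hnk ↦ idxValid_of_checkTable (prm := prm) (by norm_num [prm]) a_pos consts_valid tT19 hn hnk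
  have h21 : TabValid (2 ^ 256) a ks (20 + 1) tab :=
    h20.extend fun n hn hnk ↦ idxValid_of_checkTable (prm := prm) (by norm_num [prm]) a_pos consts_valid tT20 hn hnk
  have h22 : TabValid (2 ^ 256) a ks (21 + 1) tab :=
    h21.extend fun n hn hnk ↦ idxValid_of_checkTable (prm := prm) (by norm_num [prm]) a_pos consts_valid tT21 hn hnk
  have h23 : TabValid (2 ^ 256) a ks (22 + 1) tab :=
    h22.extend fun n hn hnk ↦ idxValid_of_checkTable (prm := prm) (by norm_num [prm]) a_pos consts_valid tT22 hn hnk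
  have h24 : TabValid (2 ^ 256) a ks (23 + 1) tab :=
    h23.extend fun n hn hnk ↦ idxValid_of_checkTable (prm := prm) (by norm_num [prm]) a_pos consts_valid tT23 hn hnk
  have h25 : TabValid (2 ^ 256) a ks (24 + 1) tab :=
    h24.extend fun n hn hnk ↦ idxValid_of_checkTable (prm := prm) (by norm_num [prm]) a_pos consts_valid tT24 hn hnk
  have h26 : TabValid (2 ^ 256) a ks (25 + 1) tab :=
    h25.extend fun n hn hnk ↦ idxValid_of_checkTable (prm := prm) (by norm_num [prm]) a_pos consts_valid tT25 hn hnk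
  exact h26

end Summit.RiemannHypothesis.RiemannHypothesis.Theorems.WeilFormatCData.O94

-- ===== from WeilFormatCDataO94TabValid2 =====
namespace Summit.RiemannHypothesis.RiemannHypothesis.Theorems.WeilFormatCData.O94
open Literature.NumberTheory.LFunctions Literature.NumberTheory.LFunctions.Yoshida1992 Encl Literature.Analysis.ValidatedNumerics.NumericsMP

/-- the special-value table is valid below `62` (partial). -/
theorem tabv62 : TabValid (2 ^ 256) O94.a O94.ks 62 O94.tab := by
  have h26 : TabValid (2 ^ 256) a ks 26 tab := tabv26
  have h27 : TabValid (2 ^ 256) a ks (26 + 1) tab :=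
    h26.extend fun n hn hnk ↦ idxValid_of_checkTable (prm := prm) (by norm_num [prm]) a_pos consts_valid tT26 hn hnk
  have h28 : TabValid (2 ^ 256) a ks (27 + 1) tab :=
    h27.extend fun n hn hnk ↦ idxValid_of_checkTable (prm := prm) (by norm_num [prm]) a_pos consts_valid tT27 hn hnk
  have h29 : TabValid (2 ^ 256) a ks (28 + 1) tab :=
    h28.extend fun n hn hnk ↦ idxValid_of_checkTable (prm := prm) (by norm_num [prm]) a_pos consts_valid tT28 hn hnk
  have h30 : TabValid (2 ^ 256) a ks (29 + 1) tab :=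
    h29.extend fun n hn hnk ↦ idxValid_of_checkTable (prm := prm) (by norm_num [prm]) a_pos consts_valid tT29 hn hnk
  have h31 : TabValid (2 ^ 256) a ks (30 + 1) tab :=
    h30.extend fun n hn hnk ↦ idxValid_of_checkTable (prm := prm) (by norm_num [prm]) a_pos consts_valid tT30 hn hnk
  have h32 : TabValid (2 ^ 256) a ks (31 + 1) tab :=
    h31.extend fun n hn hnk ↦ idxValid_of_checkTable (prm := prm) (by norm_num [prm]) a_pos consts_valid tT31 hn hnk
  have h33 : TabValid (2 ^ 256) a ks (32 + 1) tab :=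
    h32.extend fun n hn hnk ↦ idxValid_of_checkTable (prm := prm) (by norm_num [prm]) a_pos consts_valid tT32 hn hnk
  have h34 : TabValid (2 ^ 256) a ks (33 + 1) tab :=
    h33.extend fun n hn hnk ↦ idxValid_of_checkTable (prm := prm) (by norm_num [prm]) a_pos consts_valid tT33 hn hnk
  have h35 : TabValid (2 ^ 256) a ks (34 + 1) tab :=
    h34.extend fun n hn hnk ↦ idxValid_of_checkTable (prm := prm) (by norm_num [prm]) a_pos consts_valid tT34 hn hnk
  have h36 : TabValid (2 ^ 256) a ks (35 + 1) tab :=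
    h35.extend fun n hn hnk ↦ idxValid_of_checkTable (prm := prm) (by norm_num [prm]) a_pos consts_valid tT35 hn hnk
  have h37 : TabValid (2 ^ 256) a ks (36 + 1) tab :=
    h36.extend fun n hn hnk ↦ idxValid_of_checkTable (prm := prm) (by norm_num [prm]) a_pos consts_valid tT36 hn hnk
  have h38 : TabValid (2 ^ 256) a ks (37 + 1) tab :=
    h37.extend fun n hn hnk ↦ idxValid_of_checkTable (prm := prm) (by norm_num [prm]) a_pos consts_valid tT37 hn hnk
  have h39 : TabValid (2 ^ 256) a ks (38 + 1) tab :=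
    h38.extend fun n hn hnk ↦ idxValid_of_checkTable (prm := prm) (by norm_num [prm]) a_pos consts_valid tT38 hn hnk
  have h40 : TabValid (2 ^ 256) a ks (39 + 1) tab :=
    h39.extend fun n hn hnk ↦ idxValid_of_checkTable (prm := prm) (by norm_num [prm]) a_pos consts_valid tT39 hn hnk
  have h41 : TabValid (2 ^ 256) a ks (40 + 1) tab :=
    h40.extend fun n hn hnk ↦ idxValid_of_checkTable (prm := prm) (by norm_num [prm]) a_pos consts_valid tT40 hn hnk
  have h42 : TabValid (2 ^ 256) a ks (41 + 1) tab :=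
    h41.extend fun n hn hnk ↦ idxValid_of_checkTable (prm := prm) (by norm_num [prm]) a_pos consts_valid tT41 hn hnk
  have h43 : TabValid (2 ^ 256) a ks (42 + 1) tab :=
    h42.extend fun n hn hnk ↦ idxValid_of_checkTable (prm := prm) (by norm_num [prm]) a_pos consts_valid tT42 hn hnk
  have h44 : TabValid (2 ^ 256) a ks (43 + 1) tab :=
    h43.extend fun n hn hnk ↦ idxValid_of_checkTable (prm := prm) (by norm_num [prm]) a_pos consts_valid tT43 hn hnk
  have h45 : TabValid (2 ^ 256) a ks (44 + 1) tab :=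
    h44.extend fun n hn hnk ↦ idxValid_of_checkTable (prm := prm) (by norm_num [prm]) a_pos consts_valid tT44 hn hnk
  have h46 : TabValid (2 ^ 256) a ks (45 + 1) tab :=
    h45.extend fun n hn hnk ↦ idxValid_of_checkTable (prm := prm) (by norm_num [prm]) a_pos consts_valid tT45 hn hnk
  have h47 : TabValid (2 ^ 256) a ks (46 + 1) tab :=
    h46.extend fun n hn hnk ↦ idxValid_of_checkTable (prm := prm) (by norm_num [prm]) a_pos consts_valid tT46 hn hnk
  have h48 : TabValid (2 ^ 256) a ks (47 + 1) tab :=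
    h47.extend fun n hn hnk ↦ idxValid_of_checkTable (prm := prm) (by norm_num [prm]) a_pos consts_valid tT47 hn hnk
  have h49 : TabValid (2 ^ 256) a ks (48 + 1) tab :=
    h48.extend fun n hn hnk ↦ idxValid_of_checkTable (prm := prm) (by norm_num [prm]) a_pos consts_valid tT48 hn hnk
  have h50 : TabValid (2 ^ 256) a ks (49 + 1) tab :=
    h49.extend fun n hn hnk ↦ idxValid_of_checkTable (prm := prm) (by norm_num [prm]) a_pos consts_valid tT49 hn hnk
  have h51 : TabValid (2 ^ 256) a ks (50 + 1) tab :=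
    h50.extend fun n hn hnk ↦ idxValid_of_checkTable (prm := prm) (by norm_num [prm]) a_pos consts_valid tT50 hn hnk
  have h52 : TabValid (2 ^ 256) a ks (51 + 1) tab :=
    h51.extend fun n hn hnk ↦ idxValid_of_checkTable (prm := prm) (by norm_num [prm]) a_pos consts_valid tT51 hn hnk
  have h53 : TabValid (2 ^ 256) a ks (52 + 1) tab :=
    h52.extend fun n hn hnk ↦ idxValid_of_checkTable (prm := prm) (by norm_num [prm]) a_pos consts_valid tT52 hn hnk
  have h54 : TabValid (2 ^ 256) a ks (53 + 1) tab :=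
    h53.extend fun n hn hnk ↦ idxValid_of_checkTable (prm := prm) (by norm_num [prm]) a_pos consts_valid tT53 hn hnk
  have h55 : TabValid (2 ^ 256) a ks (54 + 1) tab :=
    h54.extend fun n hn hnk ↦ idxValid_of_checkTable (prm := prm) (by norm_num [prm]) a_pos consts_valid tT54 hn hnk
  have h56 : TabValid (2 ^ 256) a ks (55 + 1) tab :=
    h55.extend fun n hn hnk ↦ idxValid_of_checkTable (prm := prm) (by norm_num [prm]) a_pos consts_valid tT55 hn hnk
  have h57 : TabValid (2 ^ 256) a ks (56 + 1) tab :=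
    h56.extend fun n hn hnk ↦ idxValid_of_checkTable (prm := prm) (by norm_num [prm]) a_pos consts_valid tT56 hn hnk
  have h58 : TabValid (2 ^ 256) a ks (57 + 1) tab :=
    h57.extend fun n hn hnk ↦ idxValid_of_checkTable (prm := prm) (by norm_num [prm]) a_pos consts_valid tT57 hn hnk
  have h59 : TabValid (2 ^ 256) a ks (58 + 1) tab :=
    h58.extend fun n hn hnk ↦ idxValid_of_checkTable (prm := prm) (by norm_num [prm]) a_pos consts_valid tT58 hn hnk
  have h60 : TabValid (2 ^ 256) a ks (59 + 1) tab :=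
    h59.extend fun n hn hnk ↦ idxValid_of_checkTable (prm := prm) (by norm_num [prm]) a_pos consts_valid tT59 hn hnk
  have h61 : TabValid (2 ^ 256) a ks (60 + 1) tab :=
    h60.extend fun n hn hnk ↦ idxValid_of_checkTable (prm := prm) (by norm_num [prm]) a_pos consts_valid tT60 hn hnk
  have h62 : TabValid (2 ^ 256) a ks (61 + 1) tab :=
    h61.extend fun n hn hnk ↦ idxValid_of_checkTable (prm := prm) (by norm_num [prm]) a_pos consts_valid tT61 hn hnk
  exact h62

end Summit.RiemannHypothesis.RiemannHypothesis.Theorems.WeilFormatCData.O94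

-- ===== from WeilFormatCDataO94TabValid3 =====
namespace Summit.RiemannHypothesis.RiemannHypothesis.Theorems.WeilFormatCData.O94
open Literature.NumberTheory.LFunctions Literature.NumberTheory.LFunctions.Yoshida1992 Encl Literature.Analysis.ValidatedNumerics.NumericsMP

/-- the special-value table is valid below `98` (partial). -/
theorem tabv98 : TabValid (2 ^ 256) O94.a O94.ks 98 O94.tab := by
  have h62 : TabValid (2 ^ 256) a ks 62 tab := tabv62
  have h63 : TabValid (2 ^ 256) a ks (62 + 1) tab :=
    h62.extend fun n hn hnk ↦ idxValid_of_checkTable (prm := prm) (by norm_num [prm]) a_pos consts_valid tT62 hn hnk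
  have h64 : TabValid (2 ^ 256) a ks (63 + 1) tab :=
    h63.extend fun n hn hnk ↦ idxValid_of_checkTable (prm := prm) (by norm_num [prm]) a_pos consts_valid tT63 hn hnk
  have h65 : TabValid (2 ^ 256) a ks (64 + 1) tab :=
    h64.extend fun n hn hnk ↦ idxValid_of_checkTable (prm := prm) (by norm_num [prm]) a_pos consts_valid tT64 hn hnk
  have h66 : TabValid (2 ^ 256) a ks (65 + 1) tab :=
    h65.extend fun n hn hnk ↦ idxValid_of_checkTable (prm := prm) (by norm_num [prm]) a_pos consts_valid tT65 hn hnk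
  have h67 : TabValid (2 ^ 256) a ks (66 + 1) tab :=
    h66.extend fun n hn hnk ↦ idxValid_of_checkTable (prm := prm) (by norm_num [prm]) a_pos consts_valid tT66 hn hnk
  have h68 : TabValid (2 ^ 256) a ks (67 + 1) tab :=
    h67.extend fun n hn hnk ↦ idxValid_of_checkTable (prm := prm) (by norm_num [prm]) a_pos consts_valid tT67 hn hnk
  have h69 : TabValid (2 ^ 256) a ks (68 + 1) tab :=
    h68.extend fun n hn hnk ↦ idxValid_of_checkTable (prm := prm) (by norm_num [prm]) a_pos consts_valid tT68 hn hnk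
  have h70 : TabValid (2 ^ 256) a ks (69 + 1) tab :=
    h69.extend fun n hn hnk ↦ idxValid_of_checkTable (prm := prm) (by norm_num [prm]) a_pos consts_valid tT69 hn hnk
  have h71 : TabValid (2 ^ 256) a ks (70 + 1) tab :=
    h70.extend fun n hn hnk ↦ idxValid_of_checkTable (prm := prm) (by norm_num [prm]) a_pos consts_valid tT70 hn hnk
  have h72 : TabValid (2 ^ 256) a ks (71 + 1) tab :=
    h71.extend fun n hn hnk ↦ idxValid_of_checkTable (prm := prm) (by norm_num [prm]) a_pos consts_valid tT71 hn hnk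
  have h73 : TabValid (2 ^ 256) a ks (72 + 1) tab :=
    h72.extend fun n hn hnk ↦ idxValid_of_checkTable (prm := prm) (by norm_num [prm]) a_pos consts_valid tT72 hn hnk
  have h74 : TabValid (2 ^ 256) a ks (73 + 1) tab :=
    h73.extend fun n hn hnk ↦ idxValid_of_checkTable (prm := prm) (by norm_num [prm]) a_pos consts_valid tT73 hn hnk
  have h75 : TabValid (2 ^ 256) a ks (74 + 1) tab :=
    h74.extend fun n hn hnk ↦ idxValid_of_checkTable (prm := prm) (by norm_num [prm]) a_pos consts_valid tT74 hn hnk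
  have h76 : TabValid (2 ^ 256) a ks (75 + 1) tab :=
    h75.extend fun n hn hnk ↦ idxValid_of_checkTable (prm := prm) (by norm_num [prm]) a_pos consts_valid tT75 hn hnk
  have h77 : TabValid (2 ^ 256) a ks (76 + 1) tab :=
    h76.extend fun n hn hnk ↦ idxValid_of_checkTable (prm := prm) (by norm_num [prm]) a_pos consts_valid tT76 hn hnk
  have h78 : TabValid (2 ^ 256) a ks (77 + 1) tab :=
    h77.extend fun n hn hnk ↦ idxValid_of_checkTable (prm := prm) (by norm_num [prm]) a_pos consts_valid tT77 hn hnk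
  have h79 : TabValid (2 ^ 256) a ks (78 + 1) tab :=
    h78.extend fun n hn hnk ↦ idxValid_of_checkTable (prm := prm) (by norm_num [prm]) a_pos consts_valid tT78 hn hnk
  have h80 : TabValid (2 ^ 256) a ks (79 + 1) tab :=
    h79.extend fun n hn hnk ↦ idxValid_of_checkTable (prm := prm) (by norm_num [prm]) a_pos consts_valid tT79 hn hnk
  have h81 : TabValid (2 ^ 256) a ks (80 + 1) tab :=
    h80.extend fun n hn hnk ↦ idxValid_of_checkTable (prm := prm) (by norm_num [prm]) a_pos consts_valid tT80 hn hnk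
  have h82 : TabValid (2 ^ 256) a ks (81 + 1) tab :=
    h81.extend fun n hn hnk ↦ idxValid_of_checkTable (prm := prm) (by norm_num [prm]) a_pos consts_valid tT81 hn hnk
  have h83 : TabValid (2 ^ 256) a ks (82 + 1) tab :=
    h82.extend fun n hn hnk ↦ idxValid_of_checkTable (prm := prm) (by norm_num [prm]) a_pos consts_valid tT82 hn hnk
  have h84 : TabValid (2 ^ 256) a ks (83 + 1) tab :=
    h83.extend fun n hn hnk ↦ idxValid_of_checkTable (prm := prm) (by norm_num [prm]) a_pos consts_valid tT83 hn hnk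
  have h85 : TabValid (2 ^ 256) a ks (84 + 1) tab :=
    h84.extend fun n hn hnk ↦ idxValid_of_checkTable (prm := prm) (by norm_num [prm]) a_pos consts_valid tT84 hn hnk
  have h86 : TabValid (2 ^ 256) a ks (85 + 1) tab :=
    h85.extend fun n hn hnk ↦ idxValid_of_checkTable (prm := prm) (by norm_num [prm]) a_pos consts_valid tT85 hn hnk
  have h87 : TabValid (2 ^ 256) a ks (86 + 1) tab :=
    h86.extend fun n hn hnk ↦ idxValid_of_checkTable (prm := prm) (by norm_num [prm]) a_pos consts_valid tT86 hn hnk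
  have h88 : TabValid (2 ^ 256) a ks (87 + 1) tab :=
    h87.extend fun n hn hnk ↦ idxValid_of_checkTable (prm := prm) (by norm_num [prm]) a_pos consts_valid tT87 hn hnk
  have h89 : TabValid (2 ^ 256) a ks (88 + 1) tab :=
    h88.extend fun n hn hnk ↦ idxValid_of_checkTable (prm := prm) (by norm_num [prm]) a_pos consts_valid tT88 hn hnk
  have h90 : TabValid (2 ^ 256) a ks (89 + 1) tab :=
    h89.extend fun n hn hnk ↦ idxValid_of_checkTable (prm := prm) (by norm_num [prm]) a_pos consts_valid tT89 hn hnk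
  have h91 : TabValid (2 ^ 256) a ks (90 + 1) tab :=
    h90.extend fun n hn hnk ↦ idxValid_of_checkTable (prm := prm) (by norm_num [prm]) a_pos consts_valid tT90 hn hnk
  have h92 : TabValid (2 ^ 256) a ks (91 + 1) tab :=
    h91.extend fun n hn hnk ↦ idxValid_of_checkTable (prm := prm) (by norm_num [prm]) a_pos consts_valid tT91 hn hnk
  have h93 : TabValid (2 ^ 256) a ks (92 + 1) tab :=
    h92.extend fun n hn hnk ↦ idxValid_of_checkTable (prm := prm) (by norm_num [prm]) a_pos consts_valid tT92 hn hnk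
  have h94 : TabValid (2 ^ 256) a ks (93 + 1) tab :=
    h93.extend fun n hn hnk ↦ idxValid_of_checkTable (prm := prm) (by norm_num [prm]) a_pos consts_valid tT93 hn hnk
  have h95 : TabValid (2 ^ 256) a ks (94 + 1) tab :=
    h94.extend fun n hn hnk ↦ idxValid_of_checkTable (prm := prm) (by norm_num [prm]) a_pos consts_valid tT94 hn hnk
  have h96 : TabValid (2 ^ 256) a ks (95 + 1) tab :=
    h95.extend fun n hn hnk ↦ idxValid_of_checkTable (prm := prm) (by norm_num [prm]) a_pos consts_valid tT95 hn hnk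
  have h97 : TabValid (2 ^ 256) a ks (96 + 1) tab :=
    h96.extend fun n hn hnk ↦ idxValid_of_checkTable (prm := prm) (by norm_num [prm]) a_pos consts_valid tT96 hn hnk
  have h98 : TabValid (2 ^ 256) a ks (97 + 1) tab :=
    h97.extend fun n hn hnk ↦ idxValid_of_checkTable (prm := prm) (by norm_num [prm]) a_pos consts_valid tT97 hn hnk
  exact h98

end Summit.RiemannHypothesis.RiemannHypothesis.Theorems.WeilFormatCData.O94
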